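import Mathlib
import Summits.MatrixMultiplication.MatrixMultiplication.Theorems.FidelityWitnessesFidelityThesisSepMajorantSingleProduct

/-!
# Line `separable-majorant` for crux `FidelityWitnesses.FidelityThesis` (stmt-MatrixMultiplication-4956) —
stub `stub_frameMajorant`: the FRAME STATE as a separable majorant (`λ = r/A`)

Slots `b, c : Fin n × Fin n`.  For `r` products `x_l = u_l ⊗ v_l ∈ ℂ^{n×n} ⊗ ℂ^{n×n}` with
`N_l := ‖u_l‖² ‖v_l‖² = ‖x_l‖²`, suppose the frame has normalised Gram matrix `≥ A > 0`, i.e.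
`A · Σ_l |d_l|² N_l ≤ ‖Σ_l d_l x_l‖²` for all coefficients `d`.  Then the registered `∃`-shape of the open
stub `stub_robustnessGrowth` (a separable majorant `λ·σ`, `σ = Σ_k p_k (φ_k ⊗ ψ_k)(φ_k ⊗ ψ_k)*`,
`Σ_k p_k ‖φ_k‖² ‖ψ_k‖² ≤ 1`, in projector-free form) is inhabited with `λ = r/A` by the FRAME STATE
`σ = r⁻¹ Σ_l |x̂_l⟩⟨x̂_l|`: `m = r`, `φ = u`, `ψ = v`, `p_k = 1/(r N_k)` (card
`Cruxes/FidelityThesis/Ideas/separable-majorant-law.md`, § Why it bites (2): "feasible point `σ` = the frame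
state").  Composed with the separable majorant law this re-derives the frame conditioning law.

Proof (weighted Cauchy–Schwarz, no square roots).  For `y = Σ_l d_l x_l` and any `z`,
`⟨y, z⟩ = Σ_l d_l ζ_l` with `ζ_l = Σ_{b,c} u_l(b) v_l(c) z(b,c)`.  Termwise
`(|d_l| |ζ_l|)² ≤ (|d_l|² N_l) · (|ζ_l|² / N_l)` (equality if `N_l ≠ 0`; if `N_l = 0` then `u_l = 0` or
`v_l = 0`, so `ζ_l = 0`), hence `|⟨y,z⟩|² ≤ (Σ_l |d_l|² N_l) · (Σ_l |ζ_l|² / N_l) ≤ (‖y‖²/A) · Σ_l |ζ_l|²/N_l`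
by the frame hypothesis, and `(‖y‖²/A) Σ_l |ζ_l|²/N_l = (r/A) ‖y‖² Σ_k p_k |ζ_k|²`.  The normalisation is
`Σ_k p_k N_k = #{k : N_k ≠ 0}/r ≤ 1`.  Supports item `stmt-MatrixMultiplication-4956`; no definitions;
imports toolkit I only.
-/

namespace Summit.MatrixMultiplication.MatrixMultiplication.Theorems

open scoped BigOperators ComplexConjugate
open Literature.Computability.AlgebraicComplexity

/-- A degenerate product pairs to zero against everything: if `‖u‖² ‖v‖² = 0` (so `u = 0` or `v = 0`
on `ℂ^{n×n}`) then `Σ_{b,c} u(b) v(c) z(b,c) = 0` for every `z`. [folklore] -/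
theorem sepMajorantFM_pairing_eq_zero_of_norms {n : ℕ} (u v : Fin n × Fin n → ℂ)
    (z : Fin n × Fin n → Fin n × Fin n → ℂ) (h : (∑ b, ‖u b‖ ^ 2) * (∑ c, ‖v c‖ ^ 2) = 0) :
    ∑ b, ∑ c, u b * v c * z b c = 0 := by
  -- pattern of `RankTwoAdditivity.prod_eq_zero_of_norms` (Theorems/FidelityWitnessesRankTwoAdditivityNorms)
  rcases mul_eq_zero.mp h with h0 | h0
  · have hz : ∀ b, u b = 0 := by
      intro b
      have := (Finset.sum_eq_zero_iff_of_nonneg (fun b _ => by positivity)).mp h0 b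
        (Finset.mem_univ b)
      exact norm_eq_zero.mp (pow_eq_zero_iff (n := 2) (by norm_num) |>.mp this)
    exact Finset.sum_eq_zero fun b _ => Finset.sum_eq_zero fun c _ => by rw [hz, zero_mul, zero_mul]
  · have hz : ∀ c, v c = 0 := by
      intro c
      have := (Finset.sum_eq_zero_iff_of_nonneg (fun c _ => by positivity)).mp h0 c
        (Finset.mem_univ c)
      exact norm_eq_zero.mp (pow_eq_zero_iff (n := 2) (by norm_num) |>.mp this)
    exact Finset.sum_eq_zero fun b _ => Finset.sum_eq_zero fun c _ => by rw [hz, mul_zero, zero_mul]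

/-- Pairing a vector `y = Σ_l d_l u_l ⊗ v_l` of the span of a product frame against an arbitrary `z`,
frame vector by frame vector: `Σ_{b,c} y z = Σ_l d_l · Σ_{b,c} u_l(b) v_l(c) z(b,c)`. [folklore] -/
theorem sepMajorantFM_span_pairing {n r : ℕ} (d : Fin r → ℂ) (u v : Fin r → Fin n × Fin n → ℂ)
    (z : Fin n × Fin n → Fin n × Fin n → ℂ) :
    ∑ b, ∑ c, (∑ l, d l * u l b * v l c) * z b c = ∑ l, d l * ∑ b, ∑ c, u l b * v l c * z b c := by
  calc ∑ b, ∑ c, (∑ l, d l * u l b * v l c) * z b c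
      = ∑ b, ∑ c, ∑ l, d l * (u l b * v l c * z b c) := by
        refine Finset.sum_congr rfl fun b _ => Finset.sum_congr rfl fun c _ => ?_
        rw [Finset.sum_mul]
        exact Finset.sum_congr rfl fun l _ => by ring
    _ = ∑ b, ∑ l, ∑ c, d l * (u l b * v l c * z b c) :=
        Finset.sum_congr rfl fun b _ => Finset.sum_comm
    _ = ∑ l, ∑ b, ∑ c, d l * (u l b * v l c * z b c) := Finset.sum_comm
    _ = ∑ l, d l * ∑ b, ∑ c, u l b * v l c * z b c := by
        refine Finset.sum_congr rfl fun l _ => ?_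
        rw [Finset.mul_sum]
        exact Finset.sum_congr rfl fun b _ => by rw [Finset.mul_sum]

/-- **Frame state as a separable majorant (`λ = r/A`).**  If the `r` products `u_l ⊗ v_l ∈ ℂ^{n×n} ⊗ ℂ^{n×n}`
form a frame whose normalised Gram matrix is `≥ A > 0` (`A · Σ_l |d_l|² ‖u_l‖²‖v_l‖² ≤ ‖Σ_l d_l u_l ⊗ v_l‖²`
for all `d`), then the frame state (`m = r`, `φ = u`, `ψ = v`, `p_k = 1/(r ‖u_k‖² ‖v_k‖²)`,
`Σ_k p_k ‖φ_k‖² ‖ψ_k‖² ≤ 1`) is a separable majorant of the span with `λ = r/A`: for every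
`y = Σ_l d_l u_l ⊗ v_l` and every `z`, `|Σ_{b,c} y z|² ≤ λ ‖y‖² Σ_k p_k |Σ_{b,c} φ_k(b) ψ_k(c) z(b,c)|²` —
the registered `∃`-shape of `stub_robustnessGrowth` (card `separable-majorant-law`, § Why it bites (2):
"feasible point `σ` = the frame state").  Weighted Cauchy–Schwarz over `l` with weights `‖u_l‖²‖v_l‖²` and
the frame hypothesis. [folklore] -/
theorem stub_frameMajorant {n r : ℕ} (u v : Fin r → Fin n × Fin n → ℂ) (A : ℝ) (hA : 0 < A)
    (hframe : ∀ d : Fin r → ℂ,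
      A * ∑ l, ‖d l‖ ^ 2 * ((∑ b, ‖u l b‖ ^ 2) * ∑ c, ‖v l c‖ ^ 2) ≤
        ∑ b, ∑ c, ‖∑ l, d l * u l b * v l c‖ ^ 2) :
    ∃ (m : ℕ) (p : Fin m → ℝ) (φ ψ : Fin m → Fin n × Fin n → ℂ) (lam : ℝ),
      0 ≤ lam ∧ lam ≤ (r : ℝ) / A ∧ (∀ k, 0 ≤ p k) ∧
      (∑ k, p k * ((∑ b, ‖φ k b‖ ^ 2) * ∑ c, ‖ψ k c‖ ^ 2) ≤ 1) ∧
      ∀ (d : Fin r → ℂ) (z : Fin n × Fin n → Fin n × Fin n → ℂ),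
        ‖∑ b, ∑ c, (∑ l, d l * u l b * v l c) * z b c‖ ^ 2 ≤
          lam * (∑ b, ∑ c, ‖∑ l, d l * u l b * v l c‖ ^ 2) *
            ∑ k, p k * ‖∑ b, ∑ c, φ k b * ψ k c * z b c‖ ^ 2 := by
  -- the product weights `N l = ‖u_l‖² ‖v_l‖²` and the frame-state weights `p k = 1/(r N_k)`
  obtain ⟨N, hN⟩ : ∃ N : Fin r → ℝ, ∀ l, N l = (∑ b, ‖u l b‖ ^ 2) * ∑ c, ‖v l c‖ ^ 2 :=
    ⟨_, fun _ => rfl⟩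
  have hN0 : ∀ l, 0 ≤ N l := fun l => by rw [hN]; positivity
  obtain ⟨p, hp⟩ : ∃ p : Fin r → ℝ, ∀ k, p k = 1 / ((r : ℝ) * N k) := ⟨_, fun _ => rfl⟩
  have hp0 : ∀ k, 0 ≤ p k := fun k => by
    rw [hp]
    exact div_nonneg zero_le_one (mul_nonneg (Nat.cast_nonneg _) (hN0 k))
  have hlam0 : 0 ≤ (r : ℝ) / A := div_nonneg (Nat.cast_nonneg _) hA.le
  refine ⟨r, p, u, v, (r : ℝ) / A, hlam0, le_rfl, hp0, ?_, fun d z => ?_⟩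
  · -- normalisation `Σ_k p_k N_k ≤ Σ_k 1/r = 1` (the term is `0` if `N_k = 0`, else `1/r`)
    have hterm : ∀ k, p k * ((∑ b, ‖u k b‖ ^ 2) * ∑ c, ‖v k c‖ ^ 2) ≤ 1 / (r : ℝ) := by
      intro k
      rw [← hN, hp, one_div_mul_eq_div, mul_comm (r : ℝ) (N k), div_mul_eq_div_div]
      exact div_le_div_of_nonneg_right (div_self_le_one (N k)) (Nat.cast_nonneg r)
    calc ∑ k, p k * ((∑ b, ‖u k b‖ ^ 2) * ∑ c, ‖v k c‖ ^ 2)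
        ≤ ∑ _k : Fin r, 1 / (r : ℝ) := Finset.sum_le_sum fun k _ => hterm k
      _ = (r : ℝ) * (1 / r) := by
          rw [Finset.sum_const, Finset.card_univ, Fintype.card_fin, nsmul_eq_mul]
      _ = (r : ℝ) / r := mul_one_div _ _
      _ ≤ 1 := div_self_le_one _
  · -- the majorant inequality: `ζ l = ⟨u_l ⊗ v_l, z⟩`, `Y = ‖y‖²`
    obtain ⟨ζ, hζ⟩ : ∃ ζ : Fin r → ℂ, ∀ l, ζ l = ∑ b, ∑ c, u l b * v l c * z b c :=
      ⟨_, fun _ => rfl⟩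
    obtain ⟨Y, hY⟩ : ∃ Y : ℝ, Y = ∑ b, ∑ c, ‖∑ l, d l * u l b * v l c‖ ^ 2 := ⟨_, rfl⟩
    -- (i) degenerate products: `N_l = 0 ⇒ ζ_l = 0`
    have hζ0 : ∀ l, N l = 0 → ζ l = 0 := fun l h => by
      rw [hζ]
      exact sepMajorantFM_pairing_eq_zero_of_norms (u l) (v l) z ((hN l).symm.trans h)
    -- (ii) termwise Cauchy–Schwarz condition `(|d| |ζ|)² ≤ (|d|² N) (|ζ|² / N)`
    have hterm : ∀ l, (‖d l‖ * ‖ζ l‖) ^ 2 ≤ ‖d l‖ ^ 2 * N l * (‖ζ l‖ ^ 2 / N l) := by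
      intro l
      rcases eq_or_ne (N l) 0 with h0 | h0
      · simp [hζ0 l h0]
      · refine le_of_eq ?_
        field_simp
    -- (iii) weighted Cauchy–Schwarz over `l`
    have hCS : (∑ l, ‖d l‖ * ‖ζ l‖) ^ 2 ≤ (∑ l, ‖d l‖ ^ 2 * N l) * ∑ l, ‖ζ l‖ ^ 2 / N l :=
      Finset.sum_sq_le_sum_mul_sum_of_sq_le_mul Finset.univ
        (fun l _ => mul_nonneg (sq_nonneg _) (hN0 l)) (fun l _ => div_nonneg (sq_nonneg _) (hN0 l))
        (fun l _ => hterm l)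
    have hnorm : ‖∑ l, d l * ζ l‖ ≤ ∑ l, ‖d l‖ * ‖ζ l‖ :=
      calc ‖∑ l, d l * ζ l‖ ≤ ∑ l, ‖d l * ζ l‖ := norm_sum_le _ _
        _ = ∑ l, ‖d l‖ * ‖ζ l‖ := by simp_rw [norm_mul]
    -- (iv) the frame hypothesis at `d`: `Σ_l |d_l|² N_l ≤ Y / A`
    have hF : ∑ l, ‖d l‖ ^ 2 * N l ≤ Y / A := by
      rw [le_div_iff₀ hA, mul_comm _ A, hY]
      simp only [hN]
      exact hframe d
    have hG0 : 0 ≤ ∑ l, ‖ζ l‖ ^ 2 / N l :=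
      Finset.sum_nonneg fun l _ => div_nonneg (sq_nonneg _) (hN0 l)
    -- (v) the right-hand side in terms of `ζ`: `(r/A) Y Σ_k p_k |ζ_k|² = (Y/A) Σ_k |ζ_k|²/N_k`
    have hpair : ∑ b, ∑ c, (∑ l, d l * u l b * v l c) * z b c = ∑ l, d l * ζ l := by
      rw [sepMajorantFM_span_pairing]
      simp only [hζ]
    have hsum : ∑ k, p k * ‖∑ b, ∑ c, u k b * v k c * z b c‖ ^ 2 = ∑ k, p k * ‖ζ k‖ ^ 2 := by
      simp only [hζ]
    have hfinal : Y / A * ∑ l, ‖ζ l‖ ^ 2 / N l = (r : ℝ) / A * Y * ∑ k, p k * ‖ζ k‖ ^ 2 := by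
      rcases Nat.eq_zero_or_pos r with hr | hr
      · subst hr
        simp
      · have hr' : (r : ℝ) ≠ 0 := by exact_mod_cast hr.ne'
        have hS : ∑ k, p k * ‖ζ k‖ ^ 2 = 1 / (r : ℝ) * ∑ k, ‖ζ k‖ ^ 2 / N k := by
          rw [Finset.mul_sum]
          exact Finset.sum_congr rfl fun k _ => by rw [hp]; ring
        have hresh : (r : ℝ) / A * Y * (1 / (r : ℝ) * ∑ k, ‖ζ k‖ ^ 2 / N k) =
            (r : ℝ) * (r : ℝ)⁻¹ * (Y / A * ∑ k, ‖ζ k‖ ^ 2 / N k) := by ring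
        rw [hS, hresh, mul_inv_cancel₀ hr', one_mul]
    -- (vi) assemble
    rw [← hY, hsum]
    calc ‖∑ b, ∑ c, (∑ l, d l * u l b * v l c) * z b c‖ ^ 2
        = ‖∑ l, d l * ζ l‖ ^ 2 := by rw [hpair]
      _ ≤ (∑ l, ‖d l‖ * ‖ζ l‖) ^ 2 := pow_le_pow_left₀ (norm_nonneg _) hnorm 2
      _ ≤ (∑ l, ‖d l‖ ^ 2 * N l) * ∑ l, ‖ζ l‖ ^ 2 / N l := hCS
      _ ≤ Y / A * ∑ l, ‖ζ l‖ ^ 2 / N l := mul_le_mul_of_nonneg_right hF hG0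
      _ = (r : ℝ) / A * Y * ∑ k, p k * ‖ζ k‖ ^ 2 := hfinal

end Summit.MatrixMultiplication.MatrixMultiplication.Theorems
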